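import Mathlib
import Literature.Barriers.MatrixMultiplication.NormalizerBarrier
import Summits.MatrixMultiplication.MatrixMultiplication.Theorems.SubgroupIdentityDesigns.Negative.GradedNormalizerCount

/-!
# Pair independence and the middle criterion for subgroup identity designs (negative lemmas for the
crux `SubgroupIdentityDesigns`, stmt-MatrixMultiplication-14079)

Abstract setting (as in `GradedNormalizerCount.lean`): a finite group `G`, a BI-INVARIANT test space
`J ≤ ℂ^G` (in the crux `J = F_k|_{GL_m(𝔽_p)}`), subgroups `H₁, H₂, H₃ ≤ G` with the subgroup TPP and
an identity test `f ∈ J` (`f 1 = 1`, `f (a b c) = 0` for `abc ≠ 1`).  Write `P = H₁H₂H₃` and call a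
function `λ : G → ℂ` an ANNIHILATOR if `Σ_y λ(y) F(y) = 0` for every `F ∈ J` (i.e. `λ ⊥ J`).

## Results (sorry-free, standard axioms)

* `probe_outer_apply` — the translated test `g ↦ f(a⁻¹ g c⁻¹)` (`a ∈ H₁`, `c ∈ H₃`) reads `δ_{ac}`
  on the WHOLE product set `P`.
* `annihilator_apply_outer_eq_zero` — **SLAB SUPPORT**: an annihilator supported on `P` vanishes on
  the slab `H₁ · 1 · H₃`.  (Dual form of the identity test: the test holds iff no annihilator on `P`
  has `λ(1) ≠ 0`; the `|P| − dim J|_P` linear relations among evaluations live on `H₁(H₂ ∖ 1)H₃`.)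
* `eq_zero_of_annihilator_on_outer` / `_on_left` / `_on_right` — **PAIR INDEPENDENCE**: the double
  cosets `H₁H₃`, `H₁H₂`, `H₂H₃` are `J`-independent: a function supported there and orthogonal to `J`
  is zero; equivalently `J` restricted to each of these three sets is EVERYTHING (the evaluations at
  their points are linearly independent on `J`).  A structural sharpening of the three walls
  `|Hᵢ||Hⱼ| ≤ dim J`: in the crux it says the `|Hᵢ||Hⱼ| × N_k` character matrices
  `[ψ(tr(M · x))]_{x ∈ HᵢHⱼ, rk M ≤ k}` have full row rank — e.g. no tensor of characters
  `θ₁ ⊗ θ₃` on `H₁H₃` may have all its level-`k` Fourier sums vanish ("a common good `k`-frame").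
* `exists_biInv_test_on_mid` — **MIDDLE CRITERION (M11)**: the `H₁ × H₃`-average
  `F(g) = Σ_{a,c} f(a g c)` is an `H₁`-left/`H₃`-right invariant element of `J` with `F(b) = [b = 1]`
  on `H₂`.  So `δ_1|_{H₂}` lies in the restriction to `H₂` of the bi-invariant part `J^{H₁ × H₃}` —
  in the crux a linear system with only `|H₂|` unknowns against the functions
  `b ↦ #{(a, c) : a b c ∈ Fix(W) x}`; the exact cheap filter of the census of subgroup triples in
  small `GL_m(𝔽_p)` run by the disprover seat (Cruxes/SubgroupIdentityDesigns/Disproof.lean).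
-/

set_option linter.dupNamespace false

noncomputable section

open scoped BigOperators Classical
open Literature.Barriers.MatrixMultiplication

namespace Summit.MatrixMultiplication.MatrixMultiplication.Theorems.SubgroupIdentityDesigns.Negative

variable {G : Type} [Group G]

/-- **Pair read-out (outer pair).**  Under the subgroup TPP an identity test `f` reads, after the
two-sided translation by `(a, c) ∈ H₁ × H₃`, the delta function at `a c` on the whole product set:
`f (a⁻¹ (a' b c') c⁻¹) = [a' b c' = a c]`. -/
theorem probe_outer_apply {H₁ H₂ H₃ : Subgroup G} (htpp : SubgroupTPP H₁ H₂ H₃)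
    {f : G → ℂ} (h1 : f 1 = 1)
    (h0 : ∀ a ∈ H₁, ∀ b ∈ H₂, ∀ c ∈ H₃, a * b * c ≠ 1 → f (a * b * c) = 0)
    {a c a' b c' : G} (ha : a ∈ H₁) (hc : c ∈ H₃) (ha' : a' ∈ H₁) (hb : b ∈ H₂) (hc' : c' ∈ H₃) :
    f (a⁻¹ * (a' * b * c') * c⁻¹) = if a' * b * c' = a * c then 1 else 0 := by
  have key : a⁻¹ * (a' * b * c') * c⁻¹ = (a⁻¹ * a') * b * (c' * c⁻¹) := by group
  rw [key, idTest_apply_eq_ite htpp h1 h0 (H₁.mul_mem (H₁.inv_mem ha) ha') hb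
    (H₃.mul_mem hc' (H₃.inv_mem hc))]
  by_cases h : a' * b * c' = a * c
  · have e : (a⁻¹ * a') * b * (c' * c⁻¹) = 1 := by
      calc (a⁻¹ * a') * b * (c' * c⁻¹) = a⁻¹ * (a' * b * c') * c⁻¹ := by group
        _ = 1 := by rw [h]; group
    obtain ⟨e1, e2, e3⟩ := htpp _ (H₁.mul_mem (H₁.inv_mem ha) ha') _ hb _
      (H₃.mul_mem hc' (H₃.inv_mem hc)) e
    rw [if_pos ⟨e1, e2, e3⟩, if_pos h]
  · rw [if_neg h, if_neg]
    rintro ⟨e1, e2, e3⟩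
    apply h
    have ha1 : a' = a := by
      calc a' = a * (a⁻¹ * a') := by group
        _ = a := by rw [e1, mul_one]
    have hc1 : c' = c := by
      calc c' = (c' * c⁻¹) * c := by group
        _ = c := by rw [e3, one_mul]
    rw [ha1, e2, hc1, mul_one]

variable [Fintype G]

/-- **SLAB SUPPORT.**  For a bi-invariant `J ≤ ℂ^G`, a subgroup TPP triple with an identity test
`f ∈ J`, and any `λ : G → ℂ` supported on `H₁H₂H₃` and orthogonal to `J`: `λ(a c) = 0` for all
`a ∈ H₁`, `c ∈ H₃` — in particular `λ(1) = 0`, and `λ` lives on the slabs `H₁ (H₂ ∖ 1) H₃` only. -/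
theorem annihilator_apply_outer_eq_zero (J : Submodule ℂ (G → ℂ))
    (hJ : ∀ f ∈ J, ∀ a b : G, (fun g : G => f (a * g * b)) ∈ J)
    {H₁ H₂ H₃ : Subgroup G} (htpp : SubgroupTPP H₁ H₂ H₃)
    {f : G → ℂ} (hf : f ∈ J) (h1 : f 1 = 1)
    (h0 : ∀ a ∈ H₁, ∀ b ∈ H₂, ∀ c ∈ H₃, a * b * c ≠ 1 → f (a * b * c) = 0)
    (lam : G → ℂ) (hsupp : ∀ y, lam y ≠ 0 → ∃ a ∈ H₁, ∃ b ∈ H₂, ∃ c ∈ H₃, y = a * b * c)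
    (hann : ∀ F ∈ J, ∑ y, lam y * F y = 0)
    {a c : G} (ha : a ∈ H₁) (hc : c ∈ H₃) : lam (a * c) = 0 := by
  classical
  have h := hann _ (hJ f hf a⁻¹ c⁻¹)
  have hterm : ∀ y, lam y * f (a⁻¹ * y * c⁻¹) = if y = a * c then lam (a * c) else 0 := by
    intro y
    by_cases hy : lam y = 0
    · rw [hy, zero_mul]
      split_ifs with e
      · rw [← e, hy]
      · rfl
    · obtain ⟨a', ha', b, hb, c', hc', rfl⟩ := hsupp y hy
      rw [probe_outer_apply htpp h1 h0 ha hc ha' hb hc']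
      split_ifs with e
      · rw [mul_one, e]
      · rw [mul_zero]
  simp only [hterm, Finset.sum_ite_eq', Finset.mem_univ, if_true] at h
  exact h

/-- **OUTER PAIR INDEPENDENCE**: a function supported on `H₁H₃` and orthogonal to `J` is zero;
equivalently `J|_{H₁H₃} = ℂ^{H₁H₃}`. -/
theorem eq_zero_of_annihilator_on_outer (J : Submodule ℂ (G → ℂ))
    (hJ : ∀ f ∈ J, ∀ a b : G, (fun g : G => f (a * g * b)) ∈ J)
    {H₁ H₂ H₃ : Subgroup G} (htpp : SubgroupTPP H₁ H₂ H₃)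
    {f : G → ℂ} (hf : f ∈ J) (h1 : f 1 = 1)
    (h0 : ∀ a ∈ H₁, ∀ b ∈ H₂, ∀ c ∈ H₃, a * b * c ≠ 1 → f (a * b * c) = 0)
    (lam : G → ℂ) (hsupp : ∀ y, lam y ≠ 0 → ∃ a ∈ H₁, ∃ c ∈ H₃, y = a * c)
    (hann : ∀ F ∈ J, ∑ y, lam y * F y = 0) : lam = 0 := by
  funext y
  by_contra hy
  obtain ⟨a, ha, c, hc, rfl⟩ := hsupp y hy
  exact hy (annihilator_apply_outer_eq_zero J hJ htpp hf h1 h0 lam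
    (fun y hy' => by
      obtain ⟨a', ha', c', hc', rfl⟩ := hsupp y hy'
      exact ⟨a', ha', 1, H₂.one_mem, c', hc', by rw [mul_one]⟩) hann ha hc)

/-- **LEFT PAIR INDEPENDENCE**: `H₁H₂` is `J`-independent (probes `g ↦ f(a⁻¹ g b⁻¹)` read `δ_{ab}`
on `H₁H₂`). -/
theorem eq_zero_of_annihilator_on_left (J : Submodule ℂ (G → ℂ))
    (hJ : ∀ f ∈ J, ∀ a b : G, (fun g : G => f (a * g * b)) ∈ J)
    {H₁ H₂ H₃ : Subgroup G} (htpp : SubgroupTPP H₁ H₂ H₃)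
    {f : G → ℂ} (hf : f ∈ J) (h1 : f 1 = 1)
    (h0 : ∀ a ∈ H₁, ∀ b ∈ H₂, ∀ c ∈ H₃, a * b * c ≠ 1 → f (a * b * c) = 0)
    (lam : G → ℂ) (hsupp : ∀ y, lam y ≠ 0 → ∃ a ∈ H₁, ∃ b ∈ H₂, y = a * b)
    (hann : ∀ F ∈ J, ∑ y, lam y * F y = 0) : lam = 0 := by
  classical
  funext y
  by_contra hy
  obtain ⟨a, ha, b, hb, rfl⟩ := hsupp _ hy
  have h := hann _ (hJ f hf a⁻¹ b⁻¹)
  have hread : ∀ a' ∈ H₁, ∀ b' ∈ H₂, f (a⁻¹ * (a' * b') * b⁻¹) =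
      if a' * b' = a * b then 1 else 0 := by
    intro a' ha' b' hb'
    have key : a⁻¹ * (a' * b') * b⁻¹ = (a⁻¹ * a') * (b' * b⁻¹) * 1 := by group
    rw [key, idTest_apply_eq_ite htpp h1 h0 (H₁.mul_mem (H₁.inv_mem ha) ha')
      (H₂.mul_mem hb' (H₂.inv_mem hb)) H₃.one_mem]
    by_cases e : a' * b' = a * b
    · have e' : a⁻¹ * a' * (b' * b⁻¹) * 1 = 1 := by
        calc a⁻¹ * a' * (b' * b⁻¹) * 1 = a⁻¹ * (a' * b') * b⁻¹ := by group
          _ = 1 := by rw [e]; group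
      obtain ⟨e1, e2, -⟩ := htpp _ (H₁.mul_mem (H₁.inv_mem ha) ha') _
        (H₂.mul_mem hb' (H₂.inv_mem hb)) _ H₃.one_mem e'
      rw [if_pos ⟨e1, e2, rfl⟩, if_pos e]
    · rw [if_neg e, if_neg]
      rintro ⟨e1, e2, -⟩
      apply e
      have ha1 : a' = a := by
        calc a' = a * (a⁻¹ * a') := by group
          _ = a := by rw [e1, mul_one]
      have hb1 : b' = b := by
        calc b' = (b' * b⁻¹) * b := by group
          _ = b := by rw [e2, one_mul]
      rw [ha1, hb1]
  have hterm : ∀ y, lam y * f (a⁻¹ * y * b⁻¹) = if y = a * b then lam (a * b) else 0 := by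
    intro y
    by_cases hy0 : lam y = 0
    · rw [hy0, zero_mul]
      split_ifs with e
      · rw [← e, hy0]
      · rfl
    · obtain ⟨a', ha', b', hb', rfl⟩ := hsupp y hy0
      rw [hread a' ha' b' hb']
      split_ifs with e
      · rw [mul_one, e]
      · rw [mul_zero]
  simp only [hterm, Finset.sum_ite_eq', Finset.mem_univ, if_true] at h
  exact hy h

/-- **RIGHT PAIR INDEPENDENCE**: `H₂H₃` is `J`-independent (probes `g ↦ f(b⁻¹ g c⁻¹)` read
`δ_{bc}` on `H₂H₃`). -/
theorem eq_zero_of_annihilator_on_right (J : Submodule ℂ (G → ℂ))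
    (hJ : ∀ f ∈ J, ∀ a b : G, (fun g : G => f (a * g * b)) ∈ J)
    {H₁ H₂ H₃ : Subgroup G} (htpp : SubgroupTPP H₁ H₂ H₃)
    {f : G → ℂ} (hf : f ∈ J) (h1 : f 1 = 1)
    (h0 : ∀ a ∈ H₁, ∀ b ∈ H₂, ∀ c ∈ H₃, a * b * c ≠ 1 → f (a * b * c) = 0)
    (lam : G → ℂ) (hsupp : ∀ y, lam y ≠ 0 → ∃ b ∈ H₂, ∃ c ∈ H₃, y = b * c)
    (hann : ∀ F ∈ J, ∑ y, lam y * F y = 0) : lam = 0 := by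
  classical
  funext y
  by_contra hy
  obtain ⟨b, hb, c, hc, rfl⟩ := hsupp _ hy
  have h := hann _ (hJ f hf b⁻¹ c⁻¹)
  have hread : ∀ b' ∈ H₂, ∀ c' ∈ H₃, f (b⁻¹ * (b' * c') * c⁻¹) =
      if b' * c' = b * c then 1 else 0 := by
    intro b' hb' c' hc'
    have key : b⁻¹ * (b' * c') * c⁻¹ = 1 * (b⁻¹ * b') * (c' * c⁻¹) := by group
    rw [key, idTest_apply_eq_ite htpp h1 h0 H₁.one_mem (H₂.mul_mem (H₂.inv_mem hb) hb')
      (H₃.mul_mem hc' (H₃.inv_mem hc))]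
    by_cases e : b' * c' = b * c
    · have e' : 1 * (b⁻¹ * b') * (c' * c⁻¹) = 1 := by
        calc 1 * (b⁻¹ * b') * (c' * c⁻¹) = b⁻¹ * (b' * c') * c⁻¹ := by group
          _ = 1 := by rw [e]; group
      obtain ⟨-, e2, e3⟩ := htpp _ H₁.one_mem _ (H₂.mul_mem (H₂.inv_mem hb) hb') _
        (H₃.mul_mem hc' (H₃.inv_mem hc)) e'
      rw [if_pos ⟨rfl, e2, e3⟩, if_pos e]
    · rw [if_neg e, if_neg]
      rintro ⟨-, e2, e3⟩
      apply e
      have hb1 : b' = b := by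
        calc b' = b * (b⁻¹ * b') := by group
          _ = b := by rw [e2, mul_one]
      have hc1 : c' = c := by
        calc c' = (c' * c⁻¹) * c := by group
          _ = c := by rw [e3, one_mul]
      rw [hb1, hc1]
  have hterm : ∀ y, lam y * f (b⁻¹ * y * c⁻¹) = if y = b * c then lam (b * c) else 0 := by
    intro y
    by_cases hy0 : lam y = 0
    · rw [hy0, zero_mul]
      split_ifs with e
      · rw [← e, hy0]
      · rfl
    · obtain ⟨b', hb', c', hc', rfl⟩ := hsupp y hy0
      rw [hread b' hb' c' hc']
      split_ifs with e
      · rw [mul_one, e]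
      · rw [mul_zero]
  simp only [hterm, Finset.sum_ite_eq', Finset.mem_univ, if_true] at h
  exact hy h

/-- **MIDDLE CRITERION (M11).**  Under the subgroup TPP, an identity test `f ∈ J` yields the
`H₁`-left / `H₃`-right invariant function `F(g) = Σ_{a ∈ H₁} Σ_{c ∈ H₃} f(a g c)` in `J` with
`F(1) = 1` and `F(b) = 0` for `b ∈ H₂ ∖ 1` (the trivial-isotype component of the test). -/
theorem exists_biInv_test_on_mid (J : Submodule ℂ (G → ℂ))
    (hJ : ∀ f ∈ J, ∀ a b : G, (fun g : G => f (a * g * b)) ∈ J)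
    {H₁ H₂ H₃ : Subgroup G} (htpp : SubgroupTPP H₁ H₂ H₃)
    {f : G → ℂ} (hf : f ∈ J) (h1 : f 1 = 1)
    (h0 : ∀ a ∈ H₁, ∀ b ∈ H₂, ∀ c ∈ H₃, a * b * c ≠ 1 → f (a * b * c) = 0) :
    ∃ F ∈ J, (∀ a ∈ H₁, ∀ c ∈ H₃, ∀ g, F (a * g * c) = F g) ∧ F 1 = 1 ∧
      ∀ b ∈ H₂, b ≠ 1 → F b = 0 := by
  classical
  let F : G → ℂ := fun g => ∑ a : H₁, ∑ c : H₃, f ((a : G) * g * (c : G))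
  have hF : F ∈ J := by
    have : F = ∑ a : H₁, ∑ c : H₃, fun g => f ((a : G) * g * (c : G)) := by
      funext g; simp only [F, Finset.sum_apply]
    rw [this]
    exact Submodule.sum_mem _ fun a _ => Submodule.sum_mem _ fun c _ => hJ f hf _ _
  have hread : ∀ b ∈ H₂, F b = if b = 1 then 1 else 0 := by
    intro b hb
    simp only [F]
    have hterm : ∀ (a : H₁) (c : H₃), f ((a : G) * b * (c : G)) =
        if (a : G) = 1 ∧ b = 1 ∧ (c : G) = 1 then 1 else 0 := fun a c =>
      idTest_apply_eq_ite htpp h1 h0 a.2 hb c.2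
    simp_rw [hterm]
    by_cases hb1 : b = 1
    · subst hb1
      rw [if_pos rfl]
      rw [Finset.sum_eq_single (⟨1, H₁.one_mem⟩ : H₁)]
      · rw [Finset.sum_eq_single (⟨1, H₃.one_mem⟩ : H₃)]
        · simp
        · intro c _ hc
          rw [if_neg]
          rintro ⟨-, -, e⟩
          exact hc (Subtype.ext e)
        · intro h; exact absurd (Finset.mem_univ _) h
      · intro a _ ha
        refine Finset.sum_eq_zero fun c _ => ?_
        rw [if_neg]
        rintro ⟨e, -, -⟩
        exact ha (Subtype.ext e)
      · intro h; exact absurd (Finset.mem_univ _) h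
    · rw [if_neg hb1]
      refine Finset.sum_eq_zero fun a _ => Finset.sum_eq_zero fun c _ => ?_
      rw [if_neg]
      rintro ⟨-, e, -⟩
      exact hb1 e
  refine ⟨F, hF, ?_, ?_, ?_⟩
  · intro a ha c hc g
    simp only [F]
    have e1 : ∀ a' : H₁, ∑ c' : H₃, f ((a' : G) * (a * g * c) * (c' : G)) =
        ∑ c' : H₃, f (((a' : G) * a) * g * (c * (c' : G))) := fun a' =>
      Finset.sum_congr rfl fun c' _ => by congr 1; group
    simp_rw [e1]
    have e2 : ∀ x : G, ∑ c' : H₃, f (x * g * (c * (c' : G))) = ∑ c' : H₃, f (x * g * (c' : G)) := by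
      intro x
      exact Fintype.sum_equiv (Equiv.mulLeft (⟨c, hc⟩ : H₃)) _ _ fun c' => rfl
    simp_rw [e2]
    exact Fintype.sum_equiv (Equiv.mulRight (⟨a, ha⟩ : H₁)) _ _ fun a' => rfl
  · rw [hread 1 H₂.one_mem, if_pos rfl]
  · intro b hb hb1
    rw [hread b hb, if_neg hb1]

end Summit.MatrixMultiplication.MatrixMultiplication.Theorems.SubgroupIdentityDesigns.Negative

end
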